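import Mathlib.Data.Nat.Choose.Bounds
import Summits.ValiantsHypothesis.ValiantsHypothesis.Theses.KPlusLogSqLaw
import Summits.ValiantsHypothesis.ValiantsHypothesis.Theorems.KPlusLogSqLawWeakLiftingRegimeCollapse
import Summits.ValiantsHypothesis.ValiantsHypothesis.Theorems.KPlusLogSqLawTropicalBHessenberg
import Summits.ValiantsHypothesis.ValiantsHypothesis.Theorems.MatrixDescartes.Negative.MatrixDescartesFalseOfTropicalMonster
import Summits.ValiantsHypothesis.ValiantsHypothesis.Theorems.LacunarySymmetroidMatrixDescartesCensusKLawBridge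
import Summits.ValiantsHypothesis.ValiantsHypothesis.Theorems.LacunarySymmetroidMatrixDescartesCensusFrame
import Summits.ValiantsHypothesis.ValiantsHypothesis.Theorems.LacunarySymmetroidMatrixDescartesCensusClassicalRows

set_option linter.dupNamespace false
set_option autoImplicit false

/-! ## Route «KPlusLogSqLaw» (route-ValiantsHypothesis-KPlusLogSqLaw): BC3 birth skeleton of crux `WeakLifting` = item stmt-ValiantsHypothesis-19561
## — RE-CUT v2 (custody #2W, conjb-2 g6, 2026-08-26; desk authorisation lead R1428 (a) = crux-workfile write, route text UNCHANGED rev 8 f0fe62816c62;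
## tribunal reading J r5 + gen-6 postscripts PS-2 / PS-2 PRECISION, tribunal-valiant/addendum-KPlusLogSqLaw-val-trib-j-1-g6-ps(2).md).

HONEST FRAMING: a skeleton over OPEN conjectures of the cell pub-symmetroid; every `stub_*` is `sorry`; nothing here asserts WeakLifting, TropicalB,
B (= `Census`-currency `KPlusLogSqLaw`), MatrixDescartes or anything on VP ≠ VNP.  WHAT CHANGED AGAINST v1 (commit f43d7ec50010) and WHY:

* HONEST LABELS (p438328 `…WeakLiftingRegimeCollapse`, kernel): in the route's own cone (the other binder of `closes` is `TropicalB`) the v1 regime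
  stubs and the edge rung are ALL EQUIVALENT to B and to the crux — `weakLiftThin_iff_…`, `weakLiftFat_iff_…`, `weakLiftEdge_iff_kPlusLogSqLaw_of_tropicalB`.
  So the thin/fat split is BOOKKEEPING (kept: registered names, byte-identical signatures, and the kernel-checked glue `WeakLifting_of`), and the crux has
  ONE honest content statement, registered here as the CONTENT STUB `stub_weakLiftRungEdge` (the K = ⌊log₂ m⌋² edge): the ultimate Attack target of the
  W side (if PROVED it carries, with TropicalB, all of B — `kPlusLogSqLaw_of_tropicalB_of_weakLiftEdge`), and for exactly that reason NOT a witness of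
  weakness (J PS-2, clause [W0]: weaker-modulo-the-cone is required of a T3 plan).
* NAMED T3 PLAN RE-POINTED (J PS-2 (3) / PS-2 PRECISION (2); lead R1423 (2), R1426): the WITNESS-PLAN STUBS are the SECTOR-B ROWS ON THE TRIDIAGONAL
  (= symmetric Hessenberg) SECTOR, `stub_tridiagonalSectorB` (uniform over all formats) and `stub_tridiagonalSectorBDiag` (along the diagonal family
  (m, K) = (2^s, s²)), typed from conjb-2 g5's sketch v2 fd1087161bef3549 with the sector condition INLINED (no new tree definition): B ⇒ them by
  restriction (`tridiagonalSectorB_of_kPlusLogSqLaw` below, proved); they are NOT known to give B or WeakLifting back, even given TropicalB (a real-side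
  sector restriction — [W0] met); the sector's TROPICAL side is DECIDED in the kernel (`…Theorems.KPlusLogSqLaw.tropicalB_hessenberg`, C = 30, all
  formats), so they are exactly WeakLifting's sector analogue; [W1] in the window along the family (uniform in (m, K); K/log₂ m = s → ∞ on the diagonal);
  [W2]/[W3] as typed in J's g6 note; [W4] on landing.  Technique named for the plan (desk R1423 (2)): the continuant three-term recursion
  `f_k = a_k(x)·f_{k−1} − b_{k−1}(x)²·f_{k−2}` on a common lacunary support, KPT15-type Wronskian bounds for sparse `f g′ − f′ g` (arXiv:1205.1015,
  Thms 7–9), interlacing / Prüfer-angle additivity, mdr-p1's arrowhead–Lagrange-tower secular identities (A3 certificate 2d2a45b6893e7fd8).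
* Descartes-zone rungs of v1 kept (theorems; inside B's decided strips — calibration, NOT witnesses).

CHECKER SHAPE (ONBOARD §0): `WeakLifting_of` concludes the UNFOLDED crux from the two regime statements; `WeakLifting_skeleton : WeakLifting` is the
unique hypothesis-free theorem concluding the crux BY NAME, stubs entering by name.  Sorries: exactly the five `stub_*`. -/

namespace Summit.ValiantsHypothesis.ValiantsHypothesis.Theses.KPlusLogSqLaw


/-- local name for the tropical census row (δ-equal to `TropicalCensus.TropRootLawAt`, p406287; same text as in the registered
skeletons of `TropicalB` / `Lifting` and in v1). -/
def TropRowW (m K B : ℕ) : Prop :=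
  ∀ (d : Fin K → ℕ) (v ε : Fin m → Fin m → Fin K → ℤ) (n : ℕ) (θ : Fin (n + 1) → ℤ)
    (p : Fin (n + 1) → Equiv.Perm (Fin m) × (Fin m → Fin K)),
    (∀ i j l, (ε i j l).natAbs ≤ 1) → StrictMono θ →
    (∀ k, Summit.ValiantsHypothesis.ValiantsHypothesis.Theorems.MatrixDescartes.Negative.IsDominant d v ε (θ k) (p k)) →
    (∀ k : Fin n, Summit.ValiantsHypothesis.ValiantsHypothesis.Theorems.MatrixDescartes.Negative.termSign ε (p k.castSucc) *
      Summit.ValiantsHypothesis.ValiantsHypothesis.Theorems.MatrixDescartes.Negative.termSign ε (p k.succ) < 0) → n ≤ B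

open Summit.ValiantsHypothesis.ValiantsHypothesis.Theorems.LacunarySymmetroidMatrixDescartes

theorem weakLifting_iff_tropRowW : WeakLifting ↔ ∃ C : ℕ, ∀ m K n : ℕ, TropRowW m K n →
    RealRootLawAt m K (2 ^ (C * (K + Nat.log 2 m ^ 2)) * (n + 1)) := Iff.rfl

/-- `TropRowW` IS the tree's tropical census row (δ). -/
theorem tropRowW_iff (m K B : ℕ) : TropRowW m K B ↔ TropicalCensus.TropRootLawAt m K B := Iff.rfl

/-! ### CONTENT STUB (the crux's one honest statement modulo the cone; Attack target, NOT a T3 witness — J PS-2 [W0]) -/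

/-- **CONTENT stub — weak LIFT on the THIN EDGE `K = ⌊log₂ m⌋²`, all `m`:** `TropRowW m (log₂² m) n → RealRootLawAt m (log₂² m) (2^{C·2 log₂² m}·(n+1))`.
HONEST LABEL: given the other crux `TropicalB` this statement is EQUIVALENT to B and to `WeakLifting` (`weakLiftEdge_iff_kPlusLogSqLaw_of_tropicalB`,
`weakLifting_of_tropicalB_of_weakLiftEdge`, p438328) — it is the crux in its shortest dress, hence the W side's ultimate ATTACK TARGET (a proof moves the
judge's Attack axis to ≥ 4) and NOT a witness of weakness; unconditionally `WeakLifting ⇒` it (`weakLiftRungEdge_of_weakLifting` below) and the converse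
is not known.  Technique foreseen (val-sym-lift-p4 GAP-LIFT §7): window localisation + a per-window Descartes budget; the local Descartes rule between
archimedean dominance points is a theorem of the lift lineage. -/
theorem stub_weakLiftRungEdge :
    ∃ C : ℕ, ∀ m n : ℕ, TropRowW m (Nat.log 2 m ^ 2) n →
      RealRootLawAt m (Nat.log 2 m ^ 2) (2 ^ (C * (2 * Nat.log 2 m ^ 2)) * (n + 1)) := by
  sorry

/-! ### WITNESS-PLAN STUBS (the NAMED T3 plan of record after this re-cut: sector-B on the TRIDIAGONAL sector — J PS-2 (3), lead R1423 (2) / R1426) -/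

/-- **WITNESS-PLAN stub — SECTOR-B ON THE TRIDIAGONAL (= symmetric Hessenberg) SECTOR, all formats:** for some absolute `C`, every real symmetric
lacunary pencil `∑ l, X^(d l) • S l` whose coefficients `S l` are all TRIDIAGONAL (`(S l) i j = 0` whenever `|i − j| ≥ 2`) has at most
`2^(C·(K + ⌊log₂ m⌋²))` distinct real zeros of its determinant (census currency of B: `roots.toFinset.card`, the zero polynomial has no roots).
STATUS: OPEN in the window `c·log₂ m < K < m/2^c` (Descartes' `C(m+K−1, K−1) − 1` exceeds the bound once `K ≳ log₂² m`); B ⇒ it by restriction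
(`tridiagonalSectorB_of_kPlusLogSqLaw`); NOT known to imply B or `WeakLifting`, with or without `TropicalB` ([W0]); the sector's tropical side is the
kernel theorem `Theorems.KPlusLogSqLaw.tropicalB_hessenberg` (C = 30), so this is `WeakLifting`'s analogue on the first sector where the tropical
input is decided.  [W1] uniform over all (m, K).  Statement = conjb-2 g5 sketch v2 `SectorSketch.TridiagonalSectorB` with `IsTridiagonalFamily` inlined.
Technique (plan): continuant recursion `f_k = a_k f_{k−1} − b_{k−1}² f_{k−2}` on a common lacunary support + KPT15 Wronskian bounds (arXiv:1205.1015
Thms 7–9) + interlacing; cheapest falsifier = an engine certificate on a window format of the sector (conjb-2 g5 D2-WAKE-MEMO §5). -/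
theorem stub_tridiagonalSectorB :
    ∃ C : ℕ, ∀ (m K : ℕ) (d : Fin K → ℕ) (S : Fin K → Matrix (Fin m) (Fin m) ℝ), (∀ l, (S l).IsSymm) →
      (∀ l (i j : Fin m), (i : ℕ) + 1 < j ∨ (j : ℕ) + 1 < i → S l i j = 0) →
      (Matrix.det (∑ l, ((Polynomial.X : Polynomial ℝ) ^ d l) • (S l).map Polynomial.C)).roots.toFinset.card ≤
        2 ^ (C * (K + Nat.log 2 m ^ 2)) := by
  sorry

/-- **WITNESS-PLAN stub — the same on the DIAGONAL FAMILY `(m, K) = (2^s, s²)`** (the cleanest in-window line «where Descartes does not give it»: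
Descartes ≈ `2^(Θ(s³))`, target `2^(O(s²))`; [W1]: `K/log₂ m = s → ∞`).  Implied by `stub_tridiagonalSectorB` (`tridiagonalSectorBDiag_of_tridiagonalSectorB`,
`⌊log₂ 2^s⌋ = s`) and by B; not known to give anything back.  Statement = g5 sketch v2 `SectorSketch.TridiagonalSectorBDiag`, inlined. -/
theorem stub_tridiagonalSectorBDiag :
    ∃ C : ℕ, ∀ (s : ℕ) (d : Fin (s ^ 2) → ℕ) (S : Fin (s ^ 2) → Matrix (Fin (2 ^ s)) (Fin (2 ^ s)) ℝ), (∀ l, (S l).IsSymm) →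
      (∀ l (i j : Fin (2 ^ s)), (i : ℕ) + 1 < j ∨ (j : ℕ) + 1 < i → S l i j = 0) →
      (Matrix.det (∑ l, ((Polynomial.X : Polynomial ℝ) ^ d l) • (S l).map Polynomial.C)).roots.toFinset.card ≤
        2 ^ (C * s ^ 2) := by
  sorry

/-! ### REGIME STUBS (bookkeeping glue of `WeakLifting_of`; registered names of v1, byte-identical signatures; PROVISIONAL: in the cone each is ⟺ the crux, p438328) -/

/-- regime stub (weak LIFT, thin regime `K ≤ log₂² m`): slack `2^{C (K + log₂² m)} ≤ 2^{2 C log₂² m}`.  Implied by the strong stub `stub_liftThin` of the aside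
`Lifting` (skeleton a3bb304741a6) via `weakLiftThin_of_liftThin`; given `TropicalB` it is ⟺ B (`weakLiftThin_iff_kPlusLogSqLaw_of_tropicalB`). -/
theorem stub_weakLiftThin :
    ∃ C : ℕ, ∀ m K n : ℕ, K ≤ Nat.log 2 m ^ 2 → TropRowW m K n → RealRootLawAt m K (2 ^ (C * (K + Nat.log 2 m ^ 2)) * (n + 1)) := by
  sorry

/-- regime stub (weak LIFT, fat regime `log₂² m ≤ K`): slack `2^{C (K + log₂² m)} ≤ 2^{2 C K}`; at `m ≤ K` it is the Descartes-vacuous rung below.  Implied by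
`stub_liftFat` of the aside `Lifting`; given `TropicalB` it is ⟺ B (`weakLiftFat_iff_kPlusLogSqLaw_of_tropicalB`). -/
theorem stub_weakLiftFat :
    ∃ C : ℕ, ∀ m K n : ℕ, Nat.log 2 m ^ 2 ≤ K → TropRowW m K n → RealRootLawAt m K (2 ^ (C * (K + Nat.log 2 m ^ 2)) * (n + 1)) := by
  sorry

/-! ### Composition -/

/-- BC3 composition for `WeakLifting` (concluding the UNFOLDED crux, so that `WeakLifting_skeleton` is the unique theorem concluding the crux by
name): the two regimes glue with `C = C₁ + C₂`. -/
theorem WeakLifting_of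
    (h₁ : ∃ C : ℕ, ∀ m K n : ℕ, K ≤ Nat.log 2 m ^ 2 → TropRowW m K n → RealRootLawAt m K (2 ^ (C * (K + Nat.log 2 m ^ 2)) * (n + 1)))
    (h₂ : ∃ C : ℕ, ∀ m K n : ℕ, Nat.log 2 m ^ 2 ≤ K → TropRowW m K n → RealRootLawAt m K (2 ^ (C * (K + Nat.log 2 m ^ 2)) * (n + 1))) :
    ∃ C : ℕ, ∀ m K n : ℕ, TropRowW m K n → RealRootLawAt m K (2 ^ (C * (K + Nat.log 2 m ^ 2)) * (n + 1)) := by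
  obtain ⟨C₁, h₁⟩ := h₁
  obtain ⟨C₂, h₂⟩ := h₂
  refine ⟨C₁ + C₂, fun m K n hT => ?_⟩
  rcases le_total K (Nat.log 2 m ^ 2) with hK | hK
  · refine Census.realRootLawAt_mono (Nat.mul_le_mul_right _ (Nat.pow_le_pow_right (by norm_num) ?_)) (h₁ m K n hK hT)
    nlinarith [Nat.zero_le (C₂ * (K + Nat.log 2 m ^ 2))]
  · refine Census.realRootLawAt_mono (Nat.mul_le_mul_right _ (Nat.pow_le_pow_right (by norm_num) ?_)) (h₂ m K n hK hT)
    nlinarith [Nat.zero_le (C₁ * (K + Nat.log 2 m ^ 2))]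

/-- SKELETON THEOREM (hypothesis-free form for `#h21_check_skeleton`: stubs enter BY NAME). -/
theorem WeakLifting_skeleton : WeakLifting := WeakLifting_of stub_weakLiftThin stub_weakLiftFat

/-! ### Honesty lemmas (proved): where each stub sits relative to the crux and to B -/

/-- `WeakLifting ⇒` the content stub (instantiate `K := ⌊log₂ m⌋²`; `K + L² = 2 L²`).  The converse is NOT known unconditionally; given `TropicalB` it
holds (`weakLifting_of_tropicalB_of_weakLiftEdge`, p438328). -/
theorem weakLiftRungEdge_of_weakLifting (hW : WeakLifting) :
    ∃ C : ℕ, ∀ m n : ℕ, TropRowW m (Nat.log 2 m ^ 2) n →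
      RealRootLawAt m (Nat.log 2 m ^ 2) (2 ^ (C * (2 * Nat.log 2 m ^ 2)) * (n + 1)) := by
  obtain ⟨C, hC⟩ := hW
  refine ⟨C, fun m n hrow => ?_⟩
  have h1 := hC m (Nat.log 2 m ^ 2) n hrow
  rwa [← two_mul] at h1

/-- kernel cross-check of the CONTENT label: given `TropicalB`, the content stub's statement is ⟺ B (p438328, restated over `TropRowW`). -/
theorem weakLiftRungEdge_iff_kPlusLogSqLaw_of_tropicalB (hTB : TropicalB) :
    (∃ C : ℕ, ∀ m n : ℕ, TropRowW m (Nat.log 2 m ^ 2) n →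
      RealRootLawAt m (Nat.log 2 m ^ 2) (2 ^ (C * (2 * Nat.log 2 m ^ 2)) * (n + 1))) ↔ KPlusLogSqLaw :=
  Theorems.KPlusLogSqLaw.weakLiftEdge_iff_kPlusLogSqLaw_of_tropicalB hTB

/-- B ⇒ the tridiagonal sector row (restriction of `RealRootLawAt` to the sector; the rung is BELOW B). -/
theorem tridiagonalSectorB_of_kPlusLogSqLaw (hB : KPlusLogSqLaw) :
    ∃ C : ℕ, ∀ (m K : ℕ) (d : Fin K → ℕ) (S : Fin K → Matrix (Fin m) (Fin m) ℝ), (∀ l, (S l).IsSymm) →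
      (∀ l (i j : Fin m), (i : ℕ) + 1 < j ∨ (j : ℕ) + 1 < i → S l i j = 0) →
      (Matrix.det (∑ l, ((Polynomial.X : Polynomial ℝ) ^ d l) • (S l).map Polynomial.C)).roots.toFinset.card ≤
        2 ^ (C * (K + Nat.log 2 m ^ 2)) := by
  obtain ⟨C, hC⟩ := hB
  exact ⟨C, fun m K d S hS _ => hC m K d S hS⟩

/-- the uniform sector row ⇒ the diagonal-family row (`⌊log₂ 2^s⌋ = s`, constant `2C`). -/
theorem tridiagonalSectorBDiag_of_tridiagonalSectorB
    (h : ∃ C : ℕ, ∀ (m K : ℕ) (d : Fin K → ℕ) (S : Fin K → Matrix (Fin m) (Fin m) ℝ), (∀ l, (S l).IsSymm) →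
      (∀ l (i j : Fin m), (i : ℕ) + 1 < j ∨ (j : ℕ) + 1 < i → S l i j = 0) →
      (Matrix.det (∑ l, ((Polynomial.X : Polynomial ℝ) ^ d l) • (S l).map Polynomial.C)).roots.toFinset.card ≤
        2 ^ (C * (K + Nat.log 2 m ^ 2))) :
    ∃ C : ℕ, ∀ (s : ℕ) (d : Fin (s ^ 2) → ℕ) (S : Fin (s ^ 2) → Matrix (Fin (2 ^ s)) (Fin (2 ^ s)) ℝ), (∀ l, (S l).IsSymm) →
      (∀ l (i j : Fin (2 ^ s)), (i : ℕ) + 1 < j ∨ (j : ℕ) + 1 < i → S l i j = 0) →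
      (Matrix.det (∑ l, ((Polynomial.X : Polynomial ℝ) ^ d l) • (S l).map Polynomial.C)).roots.toFinset.card ≤
        2 ^ (C * s ^ 2) := by
  obtain ⟨C, hC⟩ := h
  refine ⟨2 * C, fun s d S hS hT => (hC (2 ^ s) (s ^ 2) d S hS hT).trans (Nat.pow_le_pow_right two_pos ?_)⟩
  rw [Nat.log_pow one_lt_two s]
  nlinarith

/-- the TROPICAL side of the sector is decided (kernel, C = 30): `TropicalB`'s statement under the Hessenberg-support hypothesis — recorded here so the
skeleton names the theorem that makes the tridiagonal row `WeakLifting`'s sector analogue. -/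
theorem tropicalB_onHessenbergSector : ∃ C : ℕ, ∀ (m K : ℕ) (d : Fin K → ℕ) (v ε : Fin m → Fin m → Fin K → ℤ) (n : ℕ)
    (θ : Fin (n + 1) → ℤ) (p : Fin (n + 1) → Equiv.Perm (Fin m) × (Fin m → Fin K)),
    Theorems.KPlusLogSqLaw.IsHessenberg ε → (∀ i j l, (ε i j l).natAbs ≤ 1) → StrictMono θ →
    (∀ k, Summit.ValiantsHypothesis.ValiantsHypothesis.Theorems.MatrixDescartes.Negative.IsDominant d v ε (θ k) (p k)) →
    (∀ k : Fin n, Summit.ValiantsHypothesis.ValiantsHypothesis.Theorems.MatrixDescartes.Negative.termSign ε (p k.castSucc) *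
      Summit.ValiantsHypothesis.ValiantsHypothesis.Theorems.MatrixDescartes.Negative.termSign ε (p k.succ) < 0) →
    n ≤ 2 ^ (C * (K + Nat.log 2 m ^ 2)) :=
  Theorems.KPlusLogSqLaw.tropicalB_hessenberg

/-! ### Strong ⇒ weak (the aside `Lifting` and each of its stubs imply the corresponding weak statement) — as in v1. -/

theorem weakLifting_of_lifting' (hL : Lifting) : WeakLifting := by
  obtain ⟨C, hC⟩ := hL
  refine ⟨C, fun m K n hT => Census.realRootLawAt_mono ?_ (hC m K n hT)⟩
  exact Nat.mul_le_mul_right _ (Nat.pow_le_pow_right (by norm_num) (Nat.mul_le_mul_left _ (Nat.le_add_right _ _)))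

theorem weakLiftThin_of_liftThin
    (h : ∃ C : ℕ, ∀ m K n : ℕ, K ≤ Nat.log 2 m ^ 2 → TropRowW m K n → RealRootLawAt m K (2 ^ (C * K) * (n + 1))) :
    ∃ C : ℕ, ∀ m K n : ℕ, K ≤ Nat.log 2 m ^ 2 → TropRowW m K n → RealRootLawAt m K (2 ^ (C * (K + Nat.log 2 m ^ 2)) * (n + 1)) := by
  obtain ⟨C, hC⟩ := h
  refine ⟨C, fun m K n hK hT => Census.realRootLawAt_mono ?_ (hC m K n hK hT)⟩
  exact Nat.mul_le_mul_right _ (Nat.pow_le_pow_right (by norm_num) (Nat.mul_le_mul_left _ (Nat.le_add_right _ _)))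

theorem weakLiftFat_of_liftFat
    (h : ∃ C : ℕ, ∀ m K n : ℕ, Nat.log 2 m ^ 2 ≤ K → TropRowW m K n → RealRootLawAt m K (2 ^ (C * K) * (n + 1))) :
    ∃ C : ℕ, ∀ m K n : ℕ, Nat.log 2 m ^ 2 ≤ K → TropRowW m K n → RealRootLawAt m K (2 ^ (C * (K + Nat.log 2 m ^ 2)) * (n + 1)) := by
  obtain ⟨C, hC⟩ := h
  refine ⟨C, fun m K n hK hT => Census.realRootLawAt_mono ?_ (hC m K n hK hT)⟩
  exact Nat.mul_le_mul_right _ (Nat.pow_le_pow_right (by norm_num) (Nat.mul_le_mul_left _ (Nat.le_add_right _ _)))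

/-! ### Descartes-zone rungs (theorems; inside B's decided strips — calibration, NOT tribunal witnesses) — as in v1. -/

theorem realRootLawAt_zero' (m B : ℕ) : RealRootLawAt m 0 B := by
  intro d S _
  have h0 : (∑ l : Fin 0, ((Polynomial.X : Polynomial ℝ) ^ d l) • (S l).map Polynomial.C) = 0 := by simp
  rw [h0]
  rcases Nat.eq_zero_or_pos m with hm | hm
  · subst hm
    simp [Matrix.det_isEmpty]
  · haveI : Nonempty (Fin m) := ⟨⟨0, hm⟩⟩
    simp [Matrix.det_zero]

/-- the real row at the fat end `m ≤ K` is below `2^(2K)` outright (Descartes). -/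
theorem realRootLawAt_fatEnd' {m K : ℕ} (hmK : m ≤ K) : RealRootLawAt m K (2 ^ (2 * K)) := by
  rcases Nat.eq_zero_or_pos K with hK | hK
  · subst hK; exact realRootLawAt_zero' m _
  refine Census.realRootLawAt_mono ?_ (Census.realRootLawAt_descartes m K hK)
  have h1 : Nat.choose (m + K - 1) m ≤ 2 ^ (m + K - 1) := Nat.choose_le_two_pow _ _
  have h2 : 2 ^ (m + K - 1) ≤ 2 ^ (2 * K - 1) := Nat.pow_le_pow_right (by norm_num) (by omega)
  have h3 : 2 * 2 ^ (2 * K - 1) = 2 ^ (2 * K) := by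
    rw [← pow_succ']; congr 1; omega
  omega

/-- **weak LIFT at the fat end `m ≤ K` (C = 2), with no tropical input** (Descartes-vacuous rung). -/
theorem WeakLifting_rung_fatEnd (m K n : ℕ) (hmK : m ≤ K) (_h : TropRowW m K n) :
    RealRootLawAt m K (2 ^ (2 * (K + Nat.log 2 m ^ 2)) * (n + 1)) := by
  refine Census.realRootLawAt_mono ?_ (realRootLawAt_fatEnd' hmK)
  calc 2 ^ (2 * K) ≤ 2 ^ (2 * (K + Nat.log 2 m ^ 2)) := Nat.pow_le_pow_right (by norm_num) (by omega)
    _ ≤ 2 ^ (2 * (K + Nat.log 2 m ^ 2)) * (n + 1) := Nat.le_mul_of_pos_right _ (Nat.succ_pos n)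

/-- **weak LIFT at `K = 2` (C = 1)**: the tree row `Census.realRootLawAt_two` (`2m+1` zeros) against the slack `2^{2 + log₂² m}·(n+1) ≥ 4·(n+1)`;
the tropical input `TropRowW m 2 n → m ≤ n` is the `DiagTwo` design of the `Lifting` skeleton (a3bb304741a6) — not re-proved here, so this rung
is stated from `m ≤ n`. -/
theorem WeakLifting_rung_two (m n : ℕ) (hmn : m ≤ n) : RealRootLawAt m 2 (2 ^ (1 * (2 + Nat.log 2 m ^ 2)) * (n + 1)) := by
  refine Census.realRootLawAt_mono ?_ (Census.realRootLawAt_two m)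
  have h4 : 4 ≤ 2 ^ (1 * (2 + Nat.log 2 m ^ 2)) := by
    calc 4 = 2 ^ 2 := by norm_num
      _ ≤ 2 ^ (1 * (2 + Nat.log 2 m ^ 2)) := Nat.pow_le_pow_right (by norm_num) (by omega)
  calc 2 * m + 1 ≤ 4 * (n + 1) := by omega
    _ ≤ 2 ^ (1 * (2 + Nat.log 2 m ^ 2)) * (n + 1) := Nat.mul_le_mul_right _ h4

end Summit.ValiantsHypothesis.ValiantsHypothesis.Theses.KPlusLogSqLaw
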